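import Literature.NumberTheory.EllipticCurves.Monsky1990.DescentLemmaFields
import Literature.NumberTheory.EllipticCurves.Tian2014.CongruentNumberTwistTransfer
import HarnessLib

/-!
# The explicit `2`-descent on `E : y² = x³ − x`: square roots `ρ_e(A)` of `x(2A) − e` and their Galois action

Monsky, *Mock Heegner points and congruent numbers*, Math. Z. 204 (1990), pp. 59, 62, reads the Galois
action on a half `A` of a point `2A = (u, ·)` off the square roots `√u, √(u + 1), √(u − 1)` ("It follows that
`σ` moves `√u` and `√(u + 1)` while `τ` fixes `√u` and moves `√(u + 1)`", p. 62; "This amounts to showing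
that `β(√u) = √u`", p. 59) — Silverman AEC Thm X.1.1 (a)+(d) at `m = 2`. This file makes that step explicit
on `E : y² = x³ − x` (the tree's `congruentNumberCurve 1`, base-changed to a field `H` of characteristic `0`),
in the elementary form of the duplication formula:

* for `A = (a, b)` with `b ≠ 0` and `e ∈ {0, 1, −1}`, `ρ_e(A) := (a² − 2ea + 1 − 2e²)/(2b)` satisfies
  `ρ_e(A)² = x(2A) − e` (`exists_two_nsmul_some_eq`, `rho_sq`);
* for a `2`-torsion point `T = (t, 0)`, `ρ_e(A + T) = ρ_e(A)` if `e = t` and `−ρ_e(A)` otherwise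
  (`some_add_twoTorsion`, `translates_eq`, `rho_translates`) — the Weil-pairing values `e₂(T, (e, 0))`;
* `ρ_e(g·A) = g(ρ_e(A))` for every `ℚ`-algebra endomorphism `g` (`rho_map`);
* `E(H)[2] = {O, (0,0), (1,0), (−1,0)}`, fixed by every `ℚ`-automorphism (`eq_of_two_nsmul_eq_zero`,
  `map_twoTorsion`), and the transfer `E_N(ℚ) → E(H)` of the tree in coordinates (`transferE_some`).

The point forms of Monsky's Lemmas 5.4 and 5.8 are assembled from these in `DescentLemmaPoints.lean`.
Everything is fully proved; no named facts.

## References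

* P. Monsky, Mock Heegner points and congruent numbers, Math. Z. 204 (1990) 45–67, Lemma 4.10 (p. 59),
  Lemma 5.4 and Remarks (2) (p. 62). [Monsky1990MockHeegner]
* J. H. Silverman, *The Arithmetic of Elliptic Curves*, 2nd ed., Thm X.1.1, Prop X.1.4, III.2.3.
  [SilvermanAEC2009]
-/

noncomputable section

open scoped Classical

open WeierstrassCurve Literature.NumberTheory.EllipticCurves Literature.NumberTheory.EllipticCurves.Tian2014

namespace Literature.NumberTheory.EllipticCurves.Monsky1990

variable {H : Type} [Field H] [CharZero H]

/-! ### The base-changed curve `E : y² = x³ − x` -/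

/-- The coefficients of `E` over `H`: `a₁ = a₂ = a₃ = a₆ = 0`, `a₄ = −1`.
[cite: Monsky1990MockHeegner, p. 45 (E : V² = U³ − U)] -/
theorem baseChange_coeffs :
    ((congruentNumberCurve 1).baseChange H).a₁ = 0 ∧ ((congruentNumberCurve 1).baseChange H).a₂ = 0 ∧
    ((congruentNumberCurve 1).baseChange H).a₃ = 0 ∧ ((congruentNumberCurve 1).baseChange H).a₄ = -1 ∧
    ((congruentNumberCurve 1).baseChange H).a₆ = 0 := by
  simp [WeierstrassCurve.baseChange, congruentNumberCurve]

/-- A point `(a, b)` of `E(H)` satisfies `b² = a³ − a`.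
[cite: Monsky1990MockHeegner, p. 45 (E : V² = U³ − U)] -/
theorem sq_eq_of_nonsingular {a b : H}
    (h : ((congruentNumberCurve 1).baseChange H).toAffine.Nonsingular a b) : b ^ 2 = a ^ 3 - a :=
  (E_nonsingular_iff a b).mp h

/-- `-(a, b) = (a, -b)` on `E`. [cite: Monsky1990MockHeegner, p. 45] -/
theorem negY_eq (a b : H) : ((congruentNumberCurve 1).baseChange H).toAffine.negY a b = -b := by
  rw [negY_baseChange_of_isCharNeTwoNF']

/-- A point of `E(H)` with `b ≠ 0` is not `2`-torsion: `2A` is an affine point.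
[cite: Monsky1990MockHeegner, p. 48 (T, the 2-division points)] -/
theorem two_nsmul_some_ne_zero {a b : H} (h : ((congruentNumberCurve 1).baseChange H).toAffine.Nonsingular a b)
    (hb : b ≠ 0) : (2 : ℕ) • (Affine.Point.some a b h : EPoint H) ≠ 0 := by
  have hne : b ≠ ((congruentNumberCurve 1).baseChange H).toAffine.negY a b := by
    rw [negY_eq]; intro e; apply hb; linear_combination e / 2
  rw [two_nsmul, Affine.Point.add_self_of_Y_ne hne]
  exact Affine.Point.some_ne_zero _

/-! ### The square roots `ρ_e(A)` of `x(2A) − e` -/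

/-- **The square root of `x(2A) − e` attached to `A = (a, b)`**, `e ∈ {0, 1, −1}`:
`ρ_e(A) = (a² − 2ea + 1 − 2e²)/(2b)` (so `ρ₀ = (a² + 1)/(2b)`, `ρ₁ = (a² − 2a − 1)/(2b)`,
`ρ₋₁ = (a² + 2a − 1)/(2b)`); Silverman AEC Thm X.1.1 (d) at `m = 2` with `f_T = x − e`, in the form of the
duplication formula `x(2A) = (a² + 1)²/(4b²)`. [cite: SilvermanAEC2009, Thm. X.1.1 (d), Prop. X.1.4] -/
def rho (e a b : H) : H := (a ^ 2 - 2 * e * a + 1 - 2 * e ^ 2) / (2 * b)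

/-- **The duplication formula**: for `A = (a, b)` with `b ≠ 0`, `x(2A) = ρ₀(A)²`.
[cite: SilvermanAEC2009, Thm. X.1.1 (d) at m = 2; Monsky1990MockHeegner, p. 62] -/
theorem exists_two_nsmul_some_eq {a b : H}
    (h : ((congruentNumberCurve 1).baseChange H).toAffine.Nonsingular a b) (hb : b ≠ 0) :
    ∃ (Y : H) (h' : ((congruentNumberCurve 1).baseChange H).toAffine.Nonsingular (rho 0 a b ^ 2) Y),
      (2 : ℕ) • (Affine.Point.some a b h : EPoint H) = Affine.Point.some (rho 0 a b ^ 2) Y h' := by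
  obtain ⟨h1, h2, h3, h4, h6⟩ := baseChange_coeffs (H := H)
  have hne : b ≠ ((congruentNumberCurve 1).baseChange H).toAffine.negY a b := by
    rw [negY_eq]; intro e; apply hb; linear_combination e / 2
  have hb2 := sq_eq_of_nonsingular h
  rw [two_nsmul, Affine.Point.add_self_of_Y_ne hne]
  have hL : ((congruentNumberCurve 1).baseChange H).toAffine.slope a a b b = (3 * a ^ 2 - 1) / (2 * b) := by
    rw [Affine.slope_of_Y_ne rfl hne, negY_eq, h1, h2, h4]
    ring
  have hX : ((congruentNumberCurve 1).baseChange H).toAffine.addX a a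
      (((congruentNumberCurve 1).baseChange H).toAffine.slope a a b b) = rho 0 a b ^ 2 := by
    rw [Affine.addX, hL, h1, h2]
    have key : ((3 * a ^ 2 - 1) / (2 * b)) ^ 2 + 0 * ((3 * a ^ 2 - 1) / (2 * b)) - 0 - a - a -
        rho 0 a b ^ 2 = (-8 * a) * (b ^ 2 - (a ^ 3 - a)) / (4 * b ^ 2) := by
      unfold rho
      field_simp
      ring
    have : ((3 * a ^ 2 - 1) / (2 * b)) ^ 2 + 0 * ((3 * a ^ 2 - 1) / (2 * b)) - 0 - a - a -
        rho 0 a b ^ 2 = 0 := by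
      rw [key, hb2, sub_self, mul_zero, zero_div]
    exact sub_eq_zero.mp this
  have hns : ((congruentNumberCurve 1).baseChange H).toAffine.Nonsingular (rho 0 a b ^ 2)
      (((congruentNumberCurve 1).baseChange H).toAffine.addY a a b
        (((congruentNumberCurve 1).baseChange H).toAffine.slope a a b b)) := by
    rw [← hX]
    exact Affine.nonsingular_add h h (fun hxy => hne hxy.2)
  refine ⟨_, hns, ?_⟩
  simp only [Affine.Point.some.injEq]
  exact ⟨hX, trivial⟩

/-- **`ρ_e(A)² = x(2A) − e`** for `e ∈ {0, 1, −1}` (i.e. `e³ = e`), `A = (a, b)`, `b ≠ 0`: the three square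
roots `√u, √(u − 1), √(u + 1)` of Monsky's argument, `u = x(2A)`.
[cite: SilvermanAEC2009, Thm. X.1.1 (d); Monsky1990MockHeegner, Lemma 5.4 proof (p. 62)] -/
theorem rho_sq {a b : H} (hb2 : b ^ 2 = a ^ 3 - a) (hb : b ≠ 0) {e : H} (he : e ^ 3 = e) :
    rho e a b ^ 2 = rho 0 a b ^ 2 - e := by
  have key : rho e a b ^ 2 - (rho 0 a b ^ 2 - e) =
      (4 * e * (b ^ 2 - (a ^ 3 - a)) - 4 * (e - e ^ 3) * (2 * a + e)) / (4 * b ^ 2) := by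
    unfold rho
    field_simp
    ring
  have h0 : e - e ^ 3 = 0 := by rw [he, sub_self]
  have : rho e a b ^ 2 - (rho 0 a b ^ 2 - e) = 0 := by
    rw [key, hb2, sub_self, mul_zero, h0, zero_sub, mul_zero, zero_mul, neg_zero, zero_div]
  exact sub_eq_zero.mp this

/-- `ρ_e(g·A) = g(ρ_e(A))` for a ring endomorphism `g` of `H` and `e ∈ ℚ`. [cite: SilvermanAEC2009, Thm. X.1.1 (a)] -/
theorem rho_map (g : H →ₐ[ℚ] H) (e : ℚ) (a b : H) : rho (e : H) (g a) (g b) = g (rho (e : H) a b) := by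
  unfold rho
  simp only [map_div₀, map_sub, map_add, map_mul, map_pow, map_ratCast, map_one, map_ofNat]

/-! ### Translation by a `2`-torsion point: the Weil-pairing signs -/

/-- **Adding a `2`-torsion point `T = (t, 0)`** (`t³ = t`) to `A = (a, b)`, `b ≠ 0`: `A + T = (a′, b′)` with
`a′ = b²/(a − t)² − a − t` and `b′ = −(b/(a − t)·(a′ − a) + b)` (the chord formulas).
[cite: SilvermanAEC2009, III.2.3 (group law)] -/
theorem some_add_twoTorsion {a b t : H}
    (h : ((congruentNumberCurve 1).baseChange H).toAffine.Nonsingular a b) (hb : b ≠ 0) (ht3 : t ^ 3 = t)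
    (ht : ((congruentNumberCurve 1).baseChange H).toAffine.Nonsingular t 0) :
    ∃ h', (Affine.Point.some a b h : EPoint H) + Affine.Point.some t 0 ht =
      Affine.Point.some (b ^ 2 / (a - t) ^ 2 - a - t)
        (-(b / (a - t) * (b ^ 2 / (a - t) ^ 2 - a - t - a) + b)) h' := by
  obtain ⟨h1, h2, h3, h4, h6⟩ := baseChange_coeffs (H := H)
  have hb2 := sq_eq_of_nonsingular h
  have hat : a ≠ t := by
    intro hat
    subst hat
    apply hb
    have : b ^ 2 = 0 := by rw [hb2]; linear_combination ht3
    exact pow_eq_zero_iff two_ne_zero |>.mp this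
  rw [Affine.Point.add_of_X_ne hat]
  have hL : ((congruentNumberCurve 1).baseChange H).toAffine.slope a t b 0 = b / (a - t) := by
    rw [Affine.slope_of_X_ne hat, sub_zero]
  have hX : ((congruentNumberCurve 1).baseChange H).toAffine.addX a t
      (((congruentNumberCurve 1).baseChange H).toAffine.slope a t b 0) = b ^ 2 / (a - t) ^ 2 - a - t := by
    rw [hL, Affine.addX, h1, h2, div_pow]
    ring
  have hY : ((congruentNumberCurve 1).baseChange H).toAffine.addY a t b
      (((congruentNumberCurve 1).baseChange H).toAffine.slope a t b 0) =
      -(b / (a - t) * (b ^ 2 / (a - t) ^ 2 - a - t - a) + b) := by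
    rw [Affine.addY, negY_eq, Affine.negAddY, hX, hL]
  have hns : ((congruentNumberCurve 1).baseChange H).toAffine.Nonsingular (b ^ 2 / (a - t) ^ 2 - a - t)
      (-(b / (a - t) * (b ^ 2 / (a - t) ^ 2 - a - t - a) + b)) := by
    rw [← hY, ← hX]
    exact Affine.nonsingular_add h ht (fun hxy => hat hxy.1)
  refine ⟨hns, ?_⟩
  simp only [Affine.Point.some.injEq]
  exact ⟨hX, hY⟩

omit [CharZero H] in
/-- **The three translates** `A + (0,0) = (−1/a, b/a²)`, `A + (1,0) = ((a+1)/(a−1), −2b/(a−1)²)`,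
`A + (−1,0) = ((1−a)/(1+a), −2b/(a+1)²)` (Silverman AEC III.2.3; Monsky p. 62 Remarks (2)).
[cite: Monsky1990MockHeegner, Remarks (2) (p. 62)] -/
theorem translates_eq {a b : H} (hb2 : b ^ 2 = a ^ 3 - a) (ha0 : a ≠ 0) (ha1 : a ≠ 1) (ha1' : a ≠ -1) :
    (b ^ 2 / (a - 0) ^ 2 - a - 0 = -1 / a ∧
      -(b / (a - 0) * (b ^ 2 / (a - 0) ^ 2 - a - 0 - a) + b) = b * (1 / a ^ 2)) ∧
    (b ^ 2 / (a - 1) ^ 2 - a - 1 = (a + 1) / (a - 1) ∧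
      -(b / (a - 1) * (b ^ 2 / (a - 1) ^ 2 - a - 1 - a) + b) = b * (-2 / (a - 1) ^ 2)) ∧
    (b ^ 2 / (a - (-1)) ^ 2 - a - (-1) = (1 - a) / (1 + a) ∧
      -(b / (a - (-1)) * (b ^ 2 / (a - (-1)) ^ 2 - a - (-1) - a) + b) = b * (-2 / (a + 1) ^ 2)) := by
  have ha1s : a - 1 ≠ 0 := sub_ne_zero.mpr ha1
  have ha1s' : a + 1 ≠ 0 := by intro h; apply ha1'; linear_combination h
  have ha1s'' : 1 + a ≠ 0 := by intro h; apply ha1'; linear_combination h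
  refine ⟨⟨?_, ?_⟩, ⟨?_, ?_⟩, ⟨?_, ?_⟩⟩
  · rw [hb2]; field_simp; ring
  · rw [hb2]; field_simp; ring
  · rw [hb2]; field_simp; ring
  · rw [hb2]; field_simp; ring
  · rw [hb2]; field_simp; ring
  · rw [hb2]; field_simp; ring

/-- **The Weil-pairing signs**: `ρ_e(A + T) = ± ρ_e(A)` with `+` iff `T = (e, 0)` — in the normalised form
`ρ_e(α, b·β) = ±ρ_e(a, b)` for the three translates. (`e₂((t,0), (e,0)) = 1` iff `t = e`.)
[cite: SilvermanAEC2009, Thm. X.1.1 (d), III.8.1; Monsky1990MockHeegner, p. 59, p. 62] -/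
theorem rho_translates {a b : H} (hb : b ≠ 0) (ha0 : a ≠ 0) (ha1 : a ≠ 1) (ha1' : a ≠ -1) :
    (rho 0 (-1 / a) (b * (1 / a ^ 2)) = rho 0 a b ∧ rho 1 (-1 / a) (b * (1 / a ^ 2)) = -rho 1 a b ∧
      rho (-1) (-1 / a) (b * (1 / a ^ 2)) = -rho (-1) a b) ∧
    (rho 0 ((a + 1) / (a - 1)) (b * (-2 / (a - 1) ^ 2)) = -rho 0 a b ∧
      rho 1 ((a + 1) / (a - 1)) (b * (-2 / (a - 1) ^ 2)) = rho 1 a b ∧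
      rho (-1) ((a + 1) / (a - 1)) (b * (-2 / (a - 1) ^ 2)) = -rho (-1) a b) ∧
    (rho 0 ((1 - a) / (1 + a)) (b * (-2 / (a + 1) ^ 2)) = -rho 0 a b ∧
      rho 1 ((1 - a) / (1 + a)) (b * (-2 / (a + 1) ^ 2)) = -rho 1 a b ∧
      rho (-1) ((1 - a) / (1 + a)) (b * (-2 / (a + 1) ^ 2)) = rho (-1) a b) := by
  have ha1s : a - 1 ≠ 0 := sub_ne_zero.mpr ha1
  have ha1s' : a + 1 ≠ 0 := by intro h; apply ha1'; linear_combination h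
  have ha1s'' : 1 + a ≠ 0 := by intro h; apply ha1'; linear_combination h
  unfold rho
  refine ⟨⟨?_, ?_, ?_⟩, ⟨?_, ?_, ?_⟩, ⟨?_, ?_, ?_⟩⟩ <;> (field_simp; ring)

/-! ### The kernel of doubling and the action on rational `2`-torsion -/

/-- **`E(H)[2] = {O, (0,0), (1,0), (−1,0)}`**: a point with `2A = O` is `O` or has `b = 0`, `a³ = a`.
[cite: Monsky1990MockHeegner, p. 48 (T = C[2]) and Remarks (2) (p. 62)] -/
theorem eq_of_two_nsmul_eq_zero (A : EPoint H) (hA : (2 : ℕ) • A = 0) :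
    A = 0 ∨ A = ptZero ∨ A = ptOne ∨ A = ptNegOne := by
  rcases A with _ | ⟨a, b, h⟩
  · exact Or.inl rfl
  · right
    by_cases hb : b = 0
    · subst hb
      have heq : (0 : H) ^ 2 = a ^ 3 - a := sq_eq_of_nonsingular h
      have hfac : a * ((a - 1) * (a + 1)) = 0 := by linear_combination -heq
      rcases mul_eq_zero.mp hfac with h0 | h1
      · left; subst h0; rfl
      · rcases mul_eq_zero.mp h1 with h1 | h1
        · right; left; rw [sub_eq_zero] at h1; subst h1; rfl
        · right; right; rw [add_eq_zero_iff_eq_neg] at h1; subst h1; rfl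
    · exact absurd hA (two_nsmul_some_ne_zero h hb)

/-- A `ℚ`-automorphism fixes the rational `2`-torsion points. [cite: Monsky1990MockHeegner, p. 48] -/
theorem map_twoTorsion (g : H ≃ₐ[ℚ] H) :
    Affine.Point.map (W' := congruentNumberCurve 1) g.toAlgHom (ptZero : EPoint H) = ptZero ∧
    Affine.Point.map (W' := congruentNumberCurve 1) g.toAlgHom (ptOne : EPoint H) = ptOne ∧
    Affine.Point.map (W' := congruentNumberCurve 1) g.toAlgHom (ptNegOne : EPoint H) = ptNegOne := by
  refine ⟨?_, ?_, ?_⟩ <;>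
    simp only [ptZero, ptOne, ptNegOne, Affine.Point.map_some, map_zero, map_one, map_neg]

/-- If `2A = O` and `g·A − A = T ≠ O` then `False`: the `2`-torsion points are fixed by `g`.
[cite: Monsky1990MockHeegner, Lemma 5.4 proof (p. 62: "If 2P ∈ T … P^σ = P")] -/
theorem map_sub_self_eq_zero_of_two_nsmul_eq_zero (g : H ≃ₐ[ℚ] H) (A : EPoint H)
    (hA : (2 : ℕ) • A = 0) : Affine.Point.map (W' := congruentNumberCurve 1) g.toAlgHom A - A = 0 := by
  obtain ⟨h0, h1, h2⟩ := map_twoTorsion g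
  rcases eq_of_two_nsmul_eq_zero A hA with rfl | rfl | rfl | rfl
  · rw [Affine.Point.map_zero, sub_zero]
  · rw [h0, sub_self]
  · rw [h1, sub_self]
  · rw [h2, sub_self]

/-- `(1, 0) ≠ O`. [cite: Monsky1990MockHeegner, Remarks (2) (p. 62)] -/
theorem ptOne_ne_zero : (ptOne : EPoint H) ≠ 0 := Affine.Point.some_ne_zero _

/-- `(−1, 0) ≠ O`. [cite: Monsky1990MockHeegner, Remarks (2) (p. 62)] -/
theorem ptNegOne_ne_zero : (ptNegOne : EPoint H) ≠ 0 := Affine.Point.some_ne_zero _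

/-! ### Unpacking the transfer -/

/-- The transfer of an affine rational point: `(x, y) ↦ (x/θ², y/θ³)`.
[cite: SilvermanAEC2009, X.5 Cor. 5.4] -/
theorem transferE_some (N : ℕ) (θ : H) (hθ2 : θ ^ 2 = algebraMap ℚ H (-(N : ℚ))) (hθ : θ ≠ 0) {x y : ℚ}
    (h : (congruentNumberCurve N).toAffine.Nonsingular x y) :
    ∃ h', transferE N θ hθ2 hθ (.some x y h) =
      Affine.Point.some ((θ ^ 2)⁻¹ * algebraMap ℚ H x) ((θ ^ 3)⁻¹ * algebraMap ℚ H y) h' := by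
  simp only [transferE, AddMonoidHom.comp_apply, AddEquiv.coe_toAddMonoidHom]
  rw [Affine.Point.congrEquiv_some]
  obtain ⟨h'', hι⟩ := ιK_some (H := H) _ (congruentNumberCurve_eq_quadraticTwist N ▸ h)
  rw [hι]
  obtain ⟨h3, he⟩ := untwistEquivAt_some (congruentNumberCurve 1) hθ2 hθ h''
  rw [he]
  exact ⟨h3, rfl⟩

/-- A rational point `(x, y)` of `E_N : y² = x³ − N²x` satisfies its equation (Monsky's `E^{(N)} : NV² = U³ − U` in the
model `y² = x³ − N²x`). [cite: Monsky1990MockHeegner, p. 45 (E^{(N)}), Lemma 3.3 (p. 53)] -/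
theorem sq_eq_of_nonsingular_N {N : ℕ} {x y : ℚ} (h : (congruentNumberCurve N).toAffine.Nonsingular x y) :
    y ^ 2 = x ^ 3 - (N : ℚ) ^ 2 * x := by
  have := h.1
  rw [Affine.equation_iff] at this
  simp only [congruentNumberCurve] at this
  linear_combination this

end Literature.NumberTheory.EllipticCurves.Monsky1990

end
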